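import Literature.Analysis.SpecialFunctions.GegenbauerHeatPositivity
import Mathlib.Analysis.SpecialFunctions.Trigonometric.Inverse
import Mathlib.Analysis.SpecialFunctions.Trigonometric.Bounds
import Mathlib.Analysis.SpecialFunctions.Exp
import Mathlib.MeasureTheory.Integral.IntervalIntegral.IntegrationByParts
import Mathlib.Analysis.Calculus.Deriv.MeanValue
import Mathlib.Analysis.Calculus.Deriv.Inv
import HarnessLib

/-!
# Cheeger–Yau comparison for the ultraspherical heat flow of `S⁴` against the Euclidean Gaussian

For the polynomial heat flow `V = gegenbauerHeat 1 b J` of `GegenbauerHeatPositivity.lean`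
(`V(s, τ) = Σ_{j<J} b_j e^{-j(j+3)τ} C_j^{(3/2)}(s)`, `∂_τ V = (1-s²)∂²_s V - 4s ∂_s V`: the heat
equation of the round `S⁴` on zonal functions, `s = cos θ`, `θ` = geodesic distance to the pole) with
non-negative initial datum `p = V(·, 0) ≥ 0` on `[-1, 1]`, and the Euclidean comparison kernel in
geodesic polar form

  `𝔤(σ, θ) = e^{-θ²/4σ}/(8σ²) = 2π² · (4πσ)⁻² e^{-θ²/4σ}`  (`gaussFour`; `2π² = vol S³`),

we prove **Cheeger–Yau's comparison at the pole** (`integral_gaussFour_mul_le_gegenbauerHeat`):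

  `∫_0^π 𝔤(t, θ) sin³θ · p(cos θ) dθ ≤ V(1, t)`   for every `t > 0`,

equivalently (`integral_weightOne_mul_gaussArccos_mul_le_gegenbauerHeat`, `s = cos θ`)
`∫_{-1}^{1} (1-s²) e^{-arccos(s)²/4t}/(8t²) · p(s) ds ≤ (P_t p)(1)`.  Paired with the duality
`∫_{-1}^{1} (1-s²) zonal(t,s) p(s) ds = (4/3) (P_t p)(1)` of the typed `S⁴` zonal series
(`SphericalZonalFourDuality.lean`) and polynomial approximation this is the Gaussian lower bound
`vol(S⁴) K_{S⁴}(t, θ) ≥ (8π²/3)(4πt)⁻² e^{-θ²/4t}` of Cheeger–Yau (Davies, *Heat kernels and spectral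
theory*, Thm 5.6.1, for `M = S⁴`: `n = 4`, `Ric = 3 ≥ 0`), i.e. the named fact
`CheegerYauZonalSphereFour` of `Literature/Geometry/Riemannian/SphericalCylinderSmallScaleDomination.lean`.

THE ARGUMENT is Cheeger–Yau's (1981) comparison in Duhamel form, written for zonal functions, where it
is one-dimensional (Davies proves Thm 5.6.1 through the Li–Yau Harnack inequality instead; the
comparison route needs no small-time asymptotics of the kernel, only that `𝔤 sin³θ dθ` is an
approximate identity):
* `gaussFour_subsolution_identity`, `mul_cos_le_sin_of_le_pi` — `𝔤` is a **subsolution** of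
  `∂_σ = L = ∂²_θ + 3 cot θ ∂_θ` because `Δ_{S⁴} θ = 3 cot θ ≤ 3/θ` (Laplacian comparison, here the
  elementary `θ cos θ ≤ sin θ` on `[0, π]`): in weak form
  `(∂_σ𝔤) sin³ - [(∂²_θ𝔤) sin³ + 3(∂_θ𝔤) sin² cos] = (3𝔤/2σ) sin²θ (θ cos θ - sin θ) ≤ 0`;
* `integral_gaussFour_mul_gegenbauerHeatDt` — the weak form of `∂_τ V = LV` against `𝔤 sin³θ dθ`
  (one fundamental theorem of calculus, `sin³` killing the boundary terms; note `𝔤` is smooth in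
  `θ` across the antipode `θ = π`, so the cut locus costs nothing here);
* `gegenbauerHeatGaussPairing` — the **Duhamel pairing** `Ψ(σ) = ∫_0^π 𝔤(σ,θ) sin³θ V(cos θ, t-σ) dθ`;
  `hasDerivAt_gegenbauerHeatGaussPairing` (differentiation under the integral),
  `deriv_gegenbauerHeatGaussPairing_nonpos` — **`Ψ' ≤ 0` on `(0, t]`** by the two items above and
  positivity preservation `V ≥ 0` (`gegenbauerHeat_nonneg`), `gegenbauerHeatGaussPairing_le`;
* `integral_gaussFour_mul_cube` (`∫_0^{θ₀} 𝔤 θ³ = 1 - (1 + θ₀²/4σ)e^{-θ₀²/4σ}`),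
  `integral_gaussFour_mul_sin_cube_le_one`, `integral_gaussFour_mul_sin_cube_tail_le`,
  `le_integral_gaussFour_mul_sin_cube`, `tendsto_gegenbauerHeatGaussPairing` — **`𝔤(σ,θ) sin³θ dθ`
  is an approximate identity at the pole**, `Ψ(σ) → V(1, t)` as `σ → 0⁺`;
* hence `Ψ(t) ≤ lim_{σ→0⁺} Ψ(σ) = V(1, t)`.

Only the `S⁴` case (`k = 1`, weight `sin³θ`) is treated.
-- TODO(general form): `S^{2k+2}`, kernel `(4πσ)^{-(k+1)} e^{-θ²/4σ}`, weight `sin^{2k+1} θ`.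
Everything is proved; no named facts.

## References
* E. B. Davies, *Heat Kernels and Spectral Theory*, CUP 1989, Thm 5.6.1 (and the notes to §5.6:
  the bound is due to Cheeger–Yau). [Davies1989]
* J. Cheeger, S.-T. Yau, *A lower bound for the heat kernel*, Comm. Pure Appl. Math. 34 (1981),
  465–480. [CheegerYau1981]
-/

noncomputable section

open Set MeasureTheory intervalIntegral Filter Real
open scoped Topology Interval BigOperators

namespace Literature.Analysis.SpecialFunctions

/-! ### The Euclidean comparison kernel in geodesic polar form -/

/-- **The `4`-dimensional Euclidean heat kernel in polar form, times `vol(S³) = 2π²`:**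
`𝔤(σ, θ) = e^{-θ²/4σ} / (8σ²) = 2π² (4πσ)⁻² e^{-θ²/4σ}`; `𝔤(σ, θ) θ³ dθ` is the radial law of the
Gaussian of variance `2σ` on `ℝ⁴` (total mass `1`), and `𝔤(σ, d(x, ·))` is the Cheeger–Yau minorant
`(4πσ)^{-n/2} e^{-d²/4σ}` of the heat kernel of a complete `4`-manifold with `Ric ≥ 0`, times `2π²`.
[cite: Davies1989, Thm 5.6.1] -/
def gaussFour (σ θ : ℝ) : ℝ := Real.exp (-θ ^ 2 / (4 * σ)) / (8 * σ ^ 2)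

/-- `𝔤 > 0`. [folklore] -/
theorem gaussFour_pos {σ : ℝ} (hσ : σ ≠ 0) (θ : ℝ) : 0 < gaussFour σ θ := by
  unfold gaussFour
  have : 0 < σ ^ 2 := by positivity
  positivity

/-- `𝔤 ≥ 0`. [folklore] -/
theorem gaussFour_nonneg (σ θ : ℝ) : 0 ≤ gaussFour σ θ := by
  unfold gaussFour; positivity

/-- `∂_θ 𝔤 = -θ/(2σ) · 𝔤`. [folklore] -/
theorem hasDerivAt_gaussFour_theta {σ : ℝ} (hσ : σ ≠ 0) (θ : ℝ) :
    HasDerivAt (fun x => gaussFour σ x) (gaussFour σ θ * (-θ / (2 * σ))) θ := by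
  unfold gaussFour
  have hx2 : HasDerivAt (fun x : ℝ => x ^ 2) (2 * θ) θ := by simpa using hasDerivAt_pow 2 θ
  have h1 : HasDerivAt (fun x : ℝ => -x ^ 2 / (4 * σ)) (-(2 * θ) / (4 * σ)) θ :=
    (hx2.neg).div_const (4 * σ)
  refine ((h1.exp).div_const (8 * σ ^ 2)).congr_deriv ?_
  field_simp
  ring

/-- `∂²_θ 𝔤 = (θ²/(4σ²) - 1/(2σ)) · 𝔤`. [folklore] -/
theorem hasDerivAt_gaussFour_theta_two {σ : ℝ} (hσ : σ ≠ 0) (θ : ℝ) :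
    HasDerivAt (fun x => gaussFour σ x * (-x / (2 * σ)))
      (gaussFour σ θ * (θ ^ 2 / (4 * σ ^ 2) - 1 / (2 * σ))) θ := by
  have h1 : HasDerivAt (fun x : ℝ => -x / (2 * σ)) (-1 / (2 * σ)) θ :=
    ((hasDerivAt_id θ).neg).div_const (2 * σ)
  refine ((hasDerivAt_gaussFour_theta hσ θ).mul h1).congr_deriv ?_
  field_simp
  ring

/-- `∂_σ 𝔤 = (θ²/(4σ²) - 2/σ) · 𝔤`. [folklore] -/
theorem hasDerivAt_gaussFour_sigma {σ : ℝ} (hσ : σ ≠ 0) (θ : ℝ) :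
    HasDerivAt (fun y => gaussFour y θ) (gaussFour σ θ * (θ ^ 2 / (4 * σ ^ 2) - 2 / σ)) σ := by
  unfold gaussFour
  have h4 : HasDerivAt (fun y : ℝ => 4 * y) 4 σ := by simpa using (hasDerivAt_id σ).const_mul 4
  have h1 : HasDerivAt (fun y : ℝ => -θ ^ 2 / (4 * y)) (θ ^ 2 / (4 * σ ^ 2)) σ := by
    refine ((hasDerivAt_const σ (-θ ^ 2)).div h4 (by positivity : (4 : ℝ) * σ ≠ 0)).congr_deriv ?_
    field_simp
    ring
  have hy2 : HasDerivAt (fun y : ℝ => y ^ 2) (2 * σ) σ := by simpa using hasDerivAt_pow 2 σ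
  have h2 : HasDerivAt (fun y : ℝ => 8 * y ^ 2) (8 * (2 * σ)) σ := hy2.const_mul 8
  refine ((h1.exp).div h2 (by positivity : (8 : ℝ) * σ ^ 2 ≠ 0)).congr_deriv ?_
  field_simp

/-- **`𝔤` is a subsolution of the radial heat equation of `S⁴`** (Cheeger–Yau: the Euclidean kernel
transplanted by the exponential map is a subsolution when `Ric ≥ 0`, here through
`Δ_{S⁴} d = 3 cot d ≤ 3/d`): with `L = ∂²_θ + 3 cot θ ∂_θ`, in the weak form used below,
`(∂_σ 𝔤) sin³θ - [(∂²_θ 𝔤) sin³θ + 3 (∂_θ 𝔤) sin²θ cos θ] = (3𝔤/2σ) sin²θ (θ cos θ - sin θ)`.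
[cite: Davies1989, Thm 5.6.1] -/
theorem gaussFour_subsolution_identity {σ : ℝ} (hσ : σ ≠ 0) (θ : ℝ) :
    gaussFour σ θ * (θ ^ 2 / (4 * σ ^ 2) - 2 / σ) * Real.sin θ ^ 3 -
      (gaussFour σ θ * (θ ^ 2 / (4 * σ ^ 2) - 1 / (2 * σ)) * Real.sin θ ^ 3 +
        3 * (gaussFour σ θ * (-θ / (2 * σ))) * Real.sin θ ^ 2 * Real.cos θ) =
      3 * gaussFour σ θ / (2 * σ) * Real.sin θ ^ 2 * (θ * Real.cos θ - Real.sin θ) := by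
  field_simp
  ring

/-- **Laplacian comparison on the sphere in its integrated form: `θ cos θ ≤ sin θ` on `[0, π]`**
(i.e. `θ cot θ ≤ 1`: `d/dθ (sin θ - θ cos θ) = θ sin θ ≥ 0`). [folklore] -/
theorem mul_cos_le_sin_of_le_pi {θ : ℝ} (h0 : 0 ≤ θ) (hπ : θ ≤ π) : θ * Real.cos θ ≤ Real.sin θ := by
  set f : ℝ → ℝ := fun x => Real.sin x - x * Real.cos x with hf
  have hderiv : ∀ x : ℝ, HasDerivAt f (x * Real.sin x) x := by
    intro x
    have h := (Real.hasDerivAt_sin x).sub ((hasDerivAt_id x).mul (Real.hasDerivAt_cos x))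
    refine h.congr_deriv ?_
    simp only [id]
    ring
  have hmono : MonotoneOn f (Icc 0 π) := by
    refine monotoneOn_of_deriv_nonneg (convex_Icc 0 π)
      (fun x _ => (hderiv x).continuousAt.continuousWithinAt)
      (fun x _ => (hderiv x).differentiableAt.differentiableWithinAt) ?_
    intro x hx
    rw [interior_Icc] at hx
    rw [(hderiv x).deriv]
    exact mul_nonneg hx.1.le (Real.sin_nonneg_of_nonneg_of_le_pi hx.1.le hx.2.le)
  have h := hmono ⟨le_rfl, Real.pi_pos.le⟩ ⟨h0, hπ⟩ h0
  simp only [hf, Real.sin_zero, zero_mul, sub_zero] at h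
  linarith

/-! ### The Duhamel pairing `Ψ(σ) = ∫_0^π 𝔤(σ, θ) sin³θ · V(cos θ, t - σ) dθ` -/

section Pairing

variable (b : ℕ → ℝ) (J : ℕ)

/-- **Weak form of `∂_τ V = L V` against `𝔤 sin³θ dθ`** (two integrations by parts in
`θ = arccos s`, no boundary terms since `sin³` vanishes at `0, π`): for the polynomial heat flow
`V = gegenbauerHeat 1 b J` (`∂_τ V = (1-s²)∂²_s V - 4s ∂_s V`, the radial heat equation of `S⁴` in
`s = cos θ`), `∫_0^π 𝔤 sin³θ (∂_τ V)(cos θ, τ) dθ = ∫_0^π [(∂²_θ 𝔤) sin³θ + 3(∂_θ 𝔤) sin²θ cos θ] V(cos θ, τ) dθ`.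
[folklore] -/
theorem integral_gaussFour_mul_gegenbauerHeatDt {σ : ℝ} (hσ : σ ≠ 0) (τ : ℝ) :
    ∫ θ in (0 : ℝ)..π, gaussFour σ θ * Real.sin θ ^ 3 * gegenbauerHeatDt 1 b J (Real.cos θ) τ =
      ∫ θ in (0 : ℝ)..π, (gaussFour σ θ * (θ ^ 2 / (4 * σ ^ 2) - 1 / (2 * σ)) * Real.sin θ ^ 3 +
        3 * (gaussFour σ θ * (-θ / (2 * σ))) * Real.sin θ ^ 2 * Real.cos θ) *
          gegenbauerHeat 1 b J (Real.cos θ) τ := by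
  set V : ℝ → ℝ := fun s => gegenbauerHeat 1 b J s τ with hV
  set Vs : ℝ → ℝ := fun s => gegenbauerHeatDs 1 b J s τ with hVs
  set Vss : ℝ → ℝ := fun s => gegenbauerHeatDss 1 b J s τ with hVss
  set Vt : ℝ → ℝ := fun s => gegenbauerHeatDt 1 b J s τ with hVt
  have hVc : Continuous V := (continuous_gegenbauerHeat 1 b J).comp (Continuous.prodMk_left τ)
  have hVsc : Continuous Vs := (continuous_gegenbauerHeatDs 1 b J).comp (Continuous.prodMk_left τ)
  have hVssc : Continuous Vss :=
    (continuous_gegenbauerHeatDss 1 b J).comp (Continuous.prodMk_left τ)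
  have hVtc : Continuous Vt := (continuous_gegenbauerHeatDt 1 b J).comp (Continuous.prodMk_left τ)
  have hgc : Continuous fun θ : ℝ => gaussFour σ θ := by unfold gaussFour; fun_prop
  -- the two integrands
  set f₁ : ℝ → ℝ := fun θ => gaussFour σ θ * Real.sin θ ^ 3 * Vt (Real.cos θ) with hf₁
  set f₂ : ℝ → ℝ := fun θ => (gaussFour σ θ * (θ ^ 2 / (4 * σ ^ 2) - 1 / (2 * σ)) * Real.sin θ ^ 3 +
    3 * (gaussFour σ θ * (-θ / (2 * σ))) * Real.sin θ ^ 2 * Real.cos θ) * V (Real.cos θ) with hf₂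
  -- `H = 𝔤 · (sin³θ ∂_θ(V∘cos)) - (∂_θ 𝔤 sin³θ) · (V∘cos)`, zero at both ends
  set H : ℝ → ℝ := fun θ => gaussFour σ θ * (-(Real.sin θ ^ 4) * Vs (Real.cos θ)) -
    gaussFour σ θ * (-θ / (2 * σ)) * Real.sin θ ^ 3 * V (Real.cos θ) with hH
  have hderiv : ∀ θ : ℝ, HasDerivAt H (f₁ θ - f₂ θ) θ := by
    intro θ
    have hVd : HasDerivAt (fun x => V (Real.cos x)) (Vs (Real.cos θ) * (-Real.sin θ)) θ :=
      (hasDerivAt_gegenbauerHeat_s 1 b J (Real.cos θ) τ).comp θ (Real.hasDerivAt_cos θ)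
    have hVsd : HasDerivAt (fun x => Vs (Real.cos x)) (Vss (Real.cos θ) * (-Real.sin θ)) θ :=
      (hasDerivAt_gegenbauerHeatDs_s 1 b J (Real.cos θ) τ).comp θ (Real.hasDerivAt_cos θ)
    have hs4 : HasDerivAt (fun x => Real.sin x ^ 4) (4 * Real.sin θ ^ 3 * Real.cos θ) θ :=
      ((Real.hasDerivAt_sin θ).fun_pow 4).congr_deriv (by norm_num)
    have hs3 : HasDerivAt (fun x => Real.sin x ^ 3) (3 * Real.sin θ ^ 2 * Real.cos θ) θ :=
      ((Real.hasDerivAt_sin θ).fun_pow 3).congr_deriv (by norm_num)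
    have h := ((hasDerivAt_gaussFour_theta hσ θ).mul (hs4.neg.mul hVsd)).sub
      (((hasDerivAt_gaussFour_theta_two hσ θ).mul hs3).mul hVd)
    refine h.congr_deriv ?_
    have hpde : Vt (Real.cos θ) = (1 - Real.cos θ ^ 2) * Vss (Real.cos θ) -
        (2 * (1 : ℕ) + 2) * Real.cos θ * Vs (Real.cos θ) := gegenbauerHeat_pde 1 b J (Real.cos θ) τ
    simp only [hf₁, hf₂, hpde, Pi.mul_apply, Pi.neg_apply]
    have hsc := Real.sin_sq_add_cos_sq θ
    push_cast
    linear_combination (gaussFour σ θ * Real.sin θ ^ 3 * Vss (Real.cos θ)) * hsc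
  have hf₁c : Continuous f₁ := by
    simp only [hf₁]
    exact (hgc.mul (by fun_prop)).mul (hVtc.comp Real.continuous_cos)
  have hf₂c : Continuous f₂ := by
    simp only [hf₂]
    exact Continuous.mul (by fun_prop) (hVc.comp Real.continuous_cos)
  have hint : IntervalIntegrable (fun θ => f₁ θ - f₂ θ) volume 0 π :=
    (hf₁c.sub hf₂c).intervalIntegrable _ _
  have hftc := intervalIntegral.integral_eq_sub_of_hasDerivAt (fun θ _ => hderiv θ) hint
  have hH0 : H 0 = 0 := by simp [hH]
  have hHπ : H π = 0 := by simp [hH]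
  rw [hH0, hHπ, sub_self, intervalIntegral.integral_sub (hf₁c.intervalIntegrable _ _)
    (hf₂c.intervalIntegrable _ _)] at hftc
  have h1 : ∫ θ in (0 : ℝ)..π, gaussFour σ θ * Real.sin θ ^ 3 * gegenbauerHeatDt 1 b J (Real.cos θ) τ =
      ∫ θ in (0 : ℝ)..π, f₁ θ := rfl
  have h2 : ∫ θ in (0 : ℝ)..π, (gaussFour σ θ * (θ ^ 2 / (4 * σ ^ 2) - 1 / (2 * σ)) * Real.sin θ ^ 3 +
      3 * (gaussFour σ θ * (-θ / (2 * σ))) * Real.sin θ ^ 2 * Real.cos θ) *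
        gegenbauerHeat 1 b J (Real.cos θ) τ = ∫ θ in (0 : ℝ)..π, f₂ θ := rfl
  rw [h1, h2]
  linarith

/-- **The Duhamel pairing** `Ψ(σ) = ∫_0^π 𝔤(σ, θ) sin³θ · V(cos θ, t - σ) dθ` of the Euclidean
kernel at time `σ` with the polynomial heat flow `V = gegenbauerHeat 1 b J` at time `t - σ`
(the zonal form of `∫_{S⁴} E(σ, x, z) (e^{(t-σ)Δ} p)(z) dz`, pole `x`, `p = V(·, 0)`). [folklore] -/
def gegenbauerHeatGaussPairing (b : ℕ → ℝ) (J : ℕ) (t σ : ℝ) : ℝ :=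
  ∫ θ in (0 : ℝ)..π, gaussFour σ θ * Real.sin θ ^ 3 * gegenbauerHeat 1 b J (Real.cos θ) (t - σ)

/-- **`Ψ` is differentiable on `σ > 0`, with derivative the integral of the `σ`-derivative of the
integrand** (`∂_σ[𝔤 V(·, t-σ)] = (∂_σ 𝔤) V - 𝔤 ∂_τ V`; differentiation under the integral sign, the
derivative being continuous, hence bounded, on `[σ/2, σ+1] × [0, π]`). [folklore] -/
theorem hasDerivAt_gegenbauerHeatGaussPairing (t : ℝ) {σ : ℝ} (hσ : 0 < σ) :
    HasDerivAt (gegenbauerHeatGaussPairing b J t)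
      (∫ θ in (0 : ℝ)..π, (gaussFour σ θ * (θ ^ 2 / (4 * σ ^ 2) - 2 / σ) * Real.sin θ ^ 3 *
          gegenbauerHeat 1 b J (Real.cos θ) (t - σ) -
        gaussFour σ θ * Real.sin θ ^ 3 * gegenbauerHeatDt 1 b J (Real.cos θ) (t - σ))) σ := by
  set S : Set ℝ := Icc (σ / 2) (σ + 1) with hS
  have hSpos : ∀ y ∈ S, y ≠ 0 := fun y hy => (lt_of_lt_of_le (by linarith) hy.1).ne'
  have hSP : ∀ p ∈ S ×ˢ (univ : Set ℝ), p.1 ≠ 0 := fun p hp => hSpos p.1 hp.1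
  have hc : Continuous fun p : ℝ × ℝ => gegenbauerHeat 1 b J p.1 p.2 := continuous_gegenbauerHeat 1 b J
  have hct : Continuous fun p : ℝ × ℝ => gegenbauerHeatDt 1 b J p.1 p.2 :=
    continuous_gegenbauerHeatDt 1 b J
  -- the integrand and its `σ`-derivative
  set F : ℝ → ℝ → ℝ := fun y θ => gaussFour y θ * Real.sin θ ^ 3 *
    gegenbauerHeat 1 b J (Real.cos θ) (t - y) with hF
  set F' : ℝ → ℝ → ℝ := fun y θ => gaussFour y θ * (θ ^ 2 / (4 * y ^ 2) - 2 / y) * Real.sin θ ^ 3 *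
      gegenbauerHeat 1 b J (Real.cos θ) (t - y) -
    gaussFour y θ * Real.sin θ ^ 3 * gegenbauerHeatDt 1 b J (Real.cos θ) (t - y) with hF'
  have hFc : ∀ y : ℝ, Continuous (F y) := by
    intro y
    simp only [hF, gaussFour]
    fun_prop
  have hF'c : ContinuousOn (fun p : ℝ × ℝ => F' p.1 p.2) (S ×ˢ univ) := by
    simp only [hF', gaussFour]
    fun_prop (disch := (intro p hp; have := hSP p hp; positivity))
  have hF'cy : Continuous (F' σ) := by
    simp only [hF', gaussFour]
    fun_prop
  -- a uniform bound on the compact box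
  obtain ⟨M, hM⟩ := (isCompact_Icc.prod isCompact_Icc).exists_bound_of_continuousOn
    (s := S ×ˢ Icc (0 : ℝ) π) (hF'c.mono (prod_mono le_rfl (subset_univ _)))
  have hIoc : Ι (0 : ℝ) π = Set.Ioc 0 π := Set.uIoc_of_le Real.pi_pos.le
  have key := intervalIntegral.hasDerivAt_integral_of_dominated_loc_of_deriv_le
    (μ := volume) (a := (0 : ℝ)) (b := π) (x₀ := σ) (s := S) (F := F) (F' := F')
    (bound := fun _ => M)
    (Icc_mem_nhds (by linarith) (by linarith))
    (Eventually.of_forall fun y => (hFc y).aestronglyMeasurable)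
    ((hFc σ).intervalIntegrable _ _)
    hF'cy.aestronglyMeasurable
    (ae_of_all _ fun θ hθ y hy => by
      rw [hIoc] at hθ
      simpa [Real.norm_eq_abs] using hM (y, θ) ⟨hy, hθ.1.le, hθ.2⟩)
    intervalIntegrable_const
    (ae_of_all _ fun θ _ y hy => by
      have hy0 : y ≠ 0 := hSpos y hy
      have hV : HasDerivAt (fun x => gegenbauerHeat 1 b J (Real.cos θ) (t - x))
          (-gegenbauerHeatDt 1 b J (Real.cos θ) (t - y)) y :=
        HasDerivAt.comp_const_sub t y (hasDerivAt_gegenbauerHeat_t 1 b J (Real.cos θ) (t - y))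
      have h := ((hasDerivAt_gaussFour_sigma hy0 θ).mul_const (Real.sin θ ^ 3)).mul hV
      refine h.congr_deriv ?_
      simp only [hF']
      ring)
  exact key.2

/-- **`Ψ' ≤ 0` on `0 < σ ≤ t`** when `V(·, 0) ≥ 0` on `[-1, 1]`: after the weak form of
`∂_τ V = LV`, `Ψ'(σ) = ∫_0^π (3𝔤/2σ) sin²θ (θ cos θ - sin θ) V(cos θ, t-σ) dθ`, and
`θ cos θ ≤ sin θ`, `V ≥ 0` (positivity preservation, `gegenbauerHeat_nonneg`). This is the sign in
Cheeger–Yau's Duhamel argument. [cite: Davies1989, Thm 5.6.1] -/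
theorem deriv_gegenbauerHeatGaussPairing_nonpos
    (h0 : ∀ s ∈ Icc (-1 : ℝ) 1, 0 ≤ gegenbauerHeat 1 b J s 0) (t : ℝ) {σ : ℝ} (hσ : 0 < σ)
    (hσt : σ ≤ t) : deriv (gegenbauerHeatGaussPairing b J t) σ ≤ 0 := by
  rw [(hasDerivAt_gegenbauerHeatGaussPairing b J t hσ).deriv]
  have hgc : Continuous fun θ : ℝ => gaussFour σ θ := by unfold gaussFour; fun_prop
  have hVc : Continuous fun θ : ℝ => gegenbauerHeat 1 b J (Real.cos θ) (t - σ) :=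
    (continuous_gegenbauerHeat 1 b J).comp (by fun_prop : Continuous fun θ : ℝ => (Real.cos θ, t - σ))
  have hVtc : Continuous fun θ : ℝ => gegenbauerHeatDt 1 b J (Real.cos θ) (t - σ) :=
    (continuous_gegenbauerHeatDt 1 b J).comp
      (by fun_prop : Continuous fun θ : ℝ => (Real.cos θ, t - σ))
  have hi1 : IntervalIntegrable (fun θ => gaussFour σ θ * (θ ^ 2 / (4 * σ ^ 2) - 2 / σ) *
      Real.sin θ ^ 3 * gegenbauerHeat 1 b J (Real.cos θ) (t - σ)) volume 0 π :=
    (((hgc.mul (by fun_prop)).mul (by fun_prop)).mul hVc).intervalIntegrable _ _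
  have hi2 : IntervalIntegrable (fun θ => gaussFour σ θ * Real.sin θ ^ 3 *
      gegenbauerHeatDt 1 b J (Real.cos θ) (t - σ)) volume 0 π :=
    ((hgc.mul (by fun_prop)).mul hVtc).intervalIntegrable _ _
  have hi3 : IntervalIntegrable (fun θ => (gaussFour σ θ * (θ ^ 2 / (4 * σ ^ 2) - 1 / (2 * σ)) *
      Real.sin θ ^ 3 + 3 * (gaussFour σ θ * (-θ / (2 * σ))) * Real.sin θ ^ 2 * Real.cos θ) *
        gegenbauerHeat 1 b J (Real.cos θ) (t - σ)) volume 0 π :=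
    (Continuous.mul (by fun_prop) hVc).intervalIntegrable _ _
  rw [intervalIntegral.integral_sub hi1 hi2,
    integral_gaussFour_mul_gegenbauerHeatDt b J hσ.ne' (t - σ), ← intervalIntegral.integral_sub hi1 hi3]
  -- the integrand is `(3𝔤/2σ) sin²θ (θ cos θ - sin θ) V ≤ 0`
  have hle : ∀ θ ∈ Icc (0 : ℝ) π,
      gaussFour σ θ * (θ ^ 2 / (4 * σ ^ 2) - 2 / σ) * Real.sin θ ^ 3 *
          gegenbauerHeat 1 b J (Real.cos θ) (t - σ) -
        (gaussFour σ θ * (θ ^ 2 / (4 * σ ^ 2) - 1 / (2 * σ)) * Real.sin θ ^ 3 +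
          3 * (gaussFour σ θ * (-θ / (2 * σ))) * Real.sin θ ^ 2 * Real.cos θ) *
          gegenbauerHeat 1 b J (Real.cos θ) (t - σ) ≤ 0 := by
    intro θ hθ
    have hid := gaussFour_subsolution_identity hσ.ne' θ
    have hV : 0 ≤ gegenbauerHeat 1 b J (Real.cos θ) (t - σ) :=
      gegenbauerHeat_nonneg 1 b J h0 (by linarith) ⟨Real.neg_one_le_cos θ, Real.cos_le_one θ⟩
    have hcs : θ * Real.cos θ - Real.sin θ ≤ 0 := by linarith [mul_cos_le_sin_of_le_pi hθ.1 hθ.2]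
    have hg : 0 ≤ 3 * gaussFour σ θ / (2 * σ) * Real.sin θ ^ 2 := by
      have := gaussFour_nonneg σ θ
      positivity
    have key : gaussFour σ θ * (θ ^ 2 / (4 * σ ^ 2) - 2 / σ) * Real.sin θ ^ 3 *
          gegenbauerHeat 1 b J (Real.cos θ) (t - σ) -
        (gaussFour σ θ * (θ ^ 2 / (4 * σ ^ 2) - 1 / (2 * σ)) * Real.sin θ ^ 3 +
          3 * (gaussFour σ θ * (-θ / (2 * σ))) * Real.sin θ ^ 2 * Real.cos θ) *
          gegenbauerHeat 1 b J (Real.cos θ) (t - σ) =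
        (3 * gaussFour σ θ / (2 * σ) * Real.sin θ ^ 2 * (θ * Real.cos θ - Real.sin θ)) *
          gegenbauerHeat 1 b J (Real.cos θ) (t - σ) := by
      rw [← hid]; ring
    rw [key]
    exact mul_nonpos_of_nonpos_of_nonneg (mul_nonpos_of_nonneg_of_nonpos hg hcs) hV
  have hneg : 0 ≤ ∫ θ in (0 : ℝ)..π, -(gaussFour σ θ * (θ ^ 2 / (4 * σ ^ 2) - 2 / σ) * Real.sin θ ^ 3 *
          gegenbauerHeat 1 b J (Real.cos θ) (t - σ) -
        (gaussFour σ θ * (θ ^ 2 / (4 * σ ^ 2) - 1 / (2 * σ)) * Real.sin θ ^ 3 +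
          3 * (gaussFour σ θ * (-θ / (2 * σ))) * Real.sin θ ^ 2 * Real.cos θ) *
          gegenbauerHeat 1 b J (Real.cos θ) (t - σ)) :=
    intervalIntegral.integral_nonneg Real.pi_pos.le fun θ hθ => by linarith [hle θ hθ]
  rw [intervalIntegral.integral_neg] at hneg
  linarith

/-- **`Ψ(t) ≤ Ψ(σ)` for `0 < σ ≤ t`** (mean value theorem on `[σ, t]`). [folklore] -/
theorem gegenbauerHeatGaussPairing_le (h0 : ∀ s ∈ Icc (-1 : ℝ) 1, 0 ≤ gegenbauerHeat 1 b J s 0)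
    {t σ : ℝ} (hσ : 0 < σ) (hσt : σ ≤ t) :
    gegenbauerHeatGaussPairing b J t t ≤ gegenbauerHeatGaussPairing b J t σ := by
  have hanti : AntitoneOn (gegenbauerHeatGaussPairing b J t) (Icc σ t) := by
    refine antitoneOn_of_deriv_nonpos (convex_Icc σ t) (fun y hy => ?_) (fun y hy => ?_)
      (fun y hy => ?_)
    · exact (hasDerivAt_gegenbauerHeatGaussPairing b J t
        (hσ.trans_le hy.1)).continuousAt.continuousWithinAt
    · rw [interior_Icc] at hy
      exact (hasDerivAt_gegenbauerHeatGaussPairing b J t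
        (hσ.trans hy.1)).differentiableAt.differentiableWithinAt
    · rw [interior_Icc] at hy
      exact deriv_gegenbauerHeatGaussPairing_nonpos b J h0 t (hσ.trans hy.1) hy.2.le
  exact hanti ⟨le_rfl, hσt⟩ ⟨hσt, le_rfl⟩ hσt

end Pairing

/-! ### `𝔤(σ, θ) sin³θ dθ` is an approximate identity at `θ = 0` as `σ → 0⁺` -/

/-- **The radial Gaussian mass**: `∫_0^{θ₀} 𝔤(σ, θ) θ³ dθ = 1 - (1 + θ₀²/4σ) e^{-θ₀²/4σ}`
(the primitive of `θ³ e^{-θ²/4σ}/(8σ²)` is `-(1 + θ²/4σ) e^{-θ²/4σ}`). [folklore] -/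
theorem integral_gaussFour_mul_cube {σ : ℝ} (hσ : σ ≠ 0) (θ₀ : ℝ) :
    ∫ θ in (0 : ℝ)..θ₀, gaussFour σ θ * θ ^ 3 =
      1 - (1 + θ₀ ^ 2 / (4 * σ)) * Real.exp (-θ₀ ^ 2 / (4 * σ)) := by
  set G : ℝ → ℝ := fun θ => -(1 + θ ^ 2 / (4 * σ)) * Real.exp (-θ ^ 2 / (4 * σ)) with hG
  have hderiv : ∀ θ : ℝ, HasDerivAt G (gaussFour σ θ * θ ^ 3) θ := by
    intro θ
    have hx2 : HasDerivAt (fun x : ℝ => x ^ 2) (2 * θ) θ := by simpa using hasDerivAt_pow 2 θ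
    have h1 : HasDerivAt (fun x : ℝ => -x ^ 2 / (4 * σ)) (-(2 * θ) / (4 * σ)) θ :=
      (hx2.neg).div_const (4 * σ)
    have hA : HasDerivAt (fun x : ℝ => -(1 + x ^ 2 / (4 * σ))) (-(2 * θ / (4 * σ))) θ :=
      ((hx2.div_const (4 * σ)).const_add 1).neg
    refine (hA.mul h1.exp).congr_deriv ?_
    unfold gaussFour
    field_simp
    ring
  have hcont : Continuous fun θ => gaussFour σ θ * θ ^ 3 := by unfold gaussFour; fun_prop
  rw [intervalIntegral.integral_eq_sub_of_hasDerivAt (fun θ _ => hderiv θ) (hcont.intervalIntegrable _ _)]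
  simp [hG]
  ring

/-- `𝔤(σ, ·)` is non-increasing on `θ ≥ 0` (for `σ > 0`). [folklore] -/
theorem gaussFour_le_gaussFour {σ : ℝ} (hσ : 0 < σ) {δ θ : ℝ} (hδ : 0 ≤ δ) (hδθ : δ ≤ θ) :
    gaussFour σ θ ≤ gaussFour σ δ := by
  unfold gaussFour
  refine div_le_div_of_nonneg_right (Real.exp_le_exp.2 ?_) (by positivity)
  rw [neg_div, neg_div, neg_le_neg_iff]
  exact div_le_div_of_nonneg_right (pow_le_pow_left₀ hδ hδθ 2) (by positivity)

/-- **Head mass ≤ 1**: `∫_0^{θ₀} 𝔤(σ, θ) sin³θ dθ ≤ 1` for `0 ≤ θ₀ ≤ π` (`0 ≤ sin θ ≤ θ`). [folklore] -/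
theorem integral_gaussFour_mul_sin_cube_le_one {σ : ℝ} (hσ : 0 < σ) {θ₀ : ℝ} (hθ₀ : 0 ≤ θ₀)
    (hθ₀π : θ₀ ≤ π) : ∫ θ in (0 : ℝ)..θ₀, gaussFour σ θ * Real.sin θ ^ 3 ≤ 1 := by
  have hg : Continuous fun θ => gaussFour σ θ := by unfold gaussFour; fun_prop
  have h1 : ∫ θ in (0 : ℝ)..θ₀, gaussFour σ θ * Real.sin θ ^ 3 ≤
      ∫ θ in (0 : ℝ)..θ₀, gaussFour σ θ * θ ^ 3 := by
    refine intervalIntegral.integral_mono_on hθ₀ ((hg.mul (by fun_prop)).intervalIntegrable _ _)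
      ((hg.mul (by fun_prop)).intervalIntegrable _ _) fun θ hθ => ?_
    refine mul_le_mul_of_nonneg_left ?_ (gaussFour_nonneg σ θ)
    exact pow_le_pow_left₀ (Real.sin_nonneg_of_nonneg_of_le_pi hθ.1 (hθ.2.trans hθ₀π))
      (Real.sin_le hθ.1) 3
  refine h1.trans ?_
  rw [integral_gaussFour_mul_cube hσ.ne']
  have : 0 ≤ (1 + θ₀ ^ 2 / (4 * σ)) * Real.exp (-θ₀ ^ 2 / (4 * σ)) := by positivity
  linarith

/-- **Tail mass**: `∫_δ^π 𝔤(σ, θ) sin³θ dθ ≤ π 𝔤(σ, δ)` for `0 ≤ δ ≤ π`. [folklore] -/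
theorem integral_gaussFour_mul_sin_cube_tail_le {σ : ℝ} (hσ : 0 < σ) {δ : ℝ} (hδ : 0 ≤ δ)
    (hδπ : δ ≤ π) : ∫ θ in δ..π, gaussFour σ θ * Real.sin θ ^ 3 ≤ π * gaussFour σ δ := by
  have hg : Continuous fun θ => gaussFour σ θ := by unfold gaussFour; fun_prop
  have h1 : ∫ θ in δ..π, gaussFour σ θ * Real.sin θ ^ 3 ≤ ∫ θ in δ..π, gaussFour σ δ := by
    refine intervalIntegral.integral_mono_on hδπ ((hg.mul (by fun_prop)).intervalIntegrable _ _)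
      intervalIntegrable_const fun θ hθ => ?_
    have hs0 : 0 ≤ Real.sin θ := Real.sin_nonneg_of_nonneg_of_le_pi (hδ.trans hθ.1) hθ.2
    have hs1 : Real.sin θ ^ 3 ≤ 1 := pow_le_one₀ hs0 (Real.sin_le_one θ)
    calc gaussFour σ θ * Real.sin θ ^ 3 ≤ gaussFour σ θ * 1 :=
          mul_le_mul_of_nonneg_left hs1 (gaussFour_nonneg σ θ)
      _ ≤ gaussFour σ δ := by rw [mul_one]; exact gaussFour_le_gaussFour hσ hδ hθ.1
  refine h1.trans ?_
  rw [intervalIntegral.integral_const, smul_eq_mul]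
  have := gaussFour_nonneg σ δ
  nlinarith

/-- **Head mass from below**: for `0 ≤ δ ≤ 1`,
`cos³δ · (1 - (1 + δ²/4σ) e^{-δ²/4σ}) ≤ ∫_0^δ 𝔤(σ, θ) sin³θ dθ` (`sin θ ≥ θ cos θ ≥ θ cos δ` on
`[0, δ]`). [folklore] -/
theorem le_integral_gaussFour_mul_sin_cube {σ : ℝ} (hσ : 0 < σ) {δ : ℝ} (hδ : 0 ≤ δ) (hδ1 : δ ≤ 1) :
    Real.cos δ ^ 3 * (1 - (1 + δ ^ 2 / (4 * σ)) * Real.exp (-δ ^ 2 / (4 * σ))) ≤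
      ∫ θ in (0 : ℝ)..δ, gaussFour σ θ * Real.sin θ ^ 3 := by
  have hg : Continuous fun θ => gaussFour σ θ := by unfold gaussFour; fun_prop
  have hδπ2 : δ ≤ π / 2 := hδ1.trans (by linarith [Real.two_le_pi])
  have hcδ : 0 ≤ Real.cos δ := Real.cos_nonneg_of_mem_Icc ⟨by linarith, hδπ2⟩
  rw [← integral_gaussFour_mul_cube hσ.ne' δ, ← intervalIntegral.integral_const_mul]
  refine intervalIntegral.integral_mono_on hδ (((hg.mul (by fun_prop)).const_mul _).intervalIntegrable
    _ _) ((hg.mul (by fun_prop)).intervalIntegrable _ _) fun θ hθ => ?_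
  have hθπ : θ ≤ π := hθ.2.trans (hδπ2.trans (by linarith [Real.pi_pos]))
  have h1 : θ * Real.cos θ ≤ Real.sin θ := mul_cos_le_sin_of_le_pi hθ.1 hθπ
  have h2 : Real.cos δ ≤ Real.cos θ :=
    Real.cos_le_cos_of_nonneg_of_le_pi hθ.1 (hδπ2.trans (by linarith [Real.pi_pos])) hθ.2
  have h3 : θ * Real.cos δ ≤ Real.sin θ := (mul_le_mul_of_nonneg_left h2 hθ.1).trans h1
  have h4 : (θ * Real.cos δ) ^ 3 ≤ Real.sin θ ^ 3 := pow_le_pow_left₀ (mul_nonneg hθ.1 hcδ) h3 3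
  calc Real.cos δ ^ 3 * (gaussFour σ θ * θ ^ 3) = gaussFour σ θ * (θ * Real.cos δ) ^ 3 := by ring
    _ ≤ gaussFour σ θ * Real.sin θ ^ 3 := mul_le_mul_of_nonneg_left h4 (gaussFour_nonneg σ θ)

/-- `1 - cos³δ ≤ 3δ²/2` for `0 ≤ δ ≤ 1` (`cos δ ≥ 1 - δ²/2` and Bernoulli). [folklore] -/
theorem one_sub_cos_cube_le {δ : ℝ} (hδ1 : |δ| ≤ 1) : 1 - Real.cos δ ^ 3 ≤ 3 * δ ^ 2 / 2 := by
  have hc : 1 - δ ^ 2 / 2 ≤ Real.cos δ := Real.one_sub_sq_div_two_le_cos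
  have hδ2 : δ ^ 2 ≤ 1 := by
    have := abs_nonneg δ
    calc δ ^ 2 = |δ| ^ 2 := (sq_abs δ).symm
      _ ≤ 1 := pow_le_one₀ this hδ1
  have hy0 : 0 ≤ 1 - δ ^ 2 / 2 := by linarith
  have h3 : (1 - δ ^ 2 / 2) ^ 3 ≤ Real.cos δ ^ 3 := pow_le_pow_left₀ hy0 hc 3
  nlinarith [sq_nonneg (δ ^ 2)]

/-- `𝔤(σ, δ) → 0` as `σ → 0⁺` for fixed `δ ≠ 0` (`u² e^{-u} → 0`, `u = δ²/4σ`). [folklore] -/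
theorem tendsto_gaussFour_nhdsGT_zero {δ : ℝ} (hδ : δ ≠ 0) :
    Tendsto (fun σ => gaussFour σ δ) (𝓝[>] 0) (𝓝 0) := by
  have hpos : 0 < δ ^ 2 / 4 := by have := sq_pos_iff.2 hδ; positivity
  have hu : Tendsto (fun σ : ℝ => δ ^ 2 / (4 * σ)) (𝓝[>] 0) atTop := by
    refine (tendsto_inv_nhdsGT_zero.const_mul_atTop hpos).congr' (Eventually.of_forall fun σ => ?_)
    simp only
    ring
  have he := ((tendsto_pow_mul_exp_neg_atTop_nhds_zero 2).comp hu).const_mul (2 / δ ^ 4)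
  rw [mul_zero] at he
  refine he.congr' ?_
  filter_upwards [self_mem_nhdsWithin] with σ hσ
  have hσ0 : σ ≠ 0 := ne_of_gt hσ
  simp only [Function.comp, gaussFour]
  rw [show -(δ ^ 2 / (4 * σ)) = -δ ^ 2 / (4 * σ) by ring]
  field_simp
  ring

/-- `(1 + δ²/4σ) e^{-δ²/4σ} → 0` as `σ → 0⁺` for fixed `δ ≠ 0`. [folklore] -/
theorem tendsto_gaussTailFactor_nhdsGT_zero {δ : ℝ} (hδ : δ ≠ 0) :
    Tendsto (fun σ => (1 + δ ^ 2 / (4 * σ)) * Real.exp (-δ ^ 2 / (4 * σ))) (𝓝[>] 0) (𝓝 0) := by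
  have hpos : 0 < δ ^ 2 / 4 := by have := sq_pos_iff.2 hδ; positivity
  have hu : Tendsto (fun σ : ℝ => δ ^ 2 / (4 * σ)) (𝓝[>] 0) atTop := by
    refine (tendsto_inv_nhdsGT_zero.const_mul_atTop hpos).congr' (Eventually.of_forall fun σ => ?_)
    simp only
    ring
  have he := ((tendsto_pow_mul_exp_neg_atTop_nhds_zero 0).add
    (tendsto_pow_mul_exp_neg_atTop_nhds_zero 1)).comp hu
  rw [add_zero] at he
  refine he.congr' (Eventually.of_forall fun σ => ?_)
  simp only [Function.comp, pow_zero, pow_one]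
  rw [show -(δ ^ 2 / (4 * σ)) = -δ ^ 2 / (4 * σ) by ring]
  ring

section Limit

variable (b : ℕ → ℝ) (J : ℕ)

/-- **`Ψ(σ) → V(1, t)` as `σ → 0⁺`**: `𝔤(σ, θ) sin³θ dθ` is an approximate identity at the pole
(`∫_0^π 𝔤 sin³ → 1`, the mass escaping every `[δ, π]`), and `V` is jointly continuous; the zonal
form of `E(σ, x, ·) → δ_x`. [folklore] -/
theorem tendsto_gegenbauerHeatGaussPairing (t : ℝ) :
    Tendsto (gegenbauerHeatGaussPairing b J t) (𝓝[>] 0) (𝓝 (gegenbauerHeat 1 b J 1 t)) := by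
  set L := gegenbauerHeat 1 b J 1 t with hL
  -- a bound for `V` on `[-1, 1] × [t - 1, t]`
  obtain ⟨M, hM⟩ := exists_bound_on_box_symm (continuous_gegenbauerHeat 1 b J) (t - 1) t
  have hLM : |L| ≤ M := hM 1 ⟨by norm_num, le_rfl⟩ t ⟨by linarith, le_rfl⟩
  have hM0 : 0 ≤ M := (abs_nonneg _).trans hLM
  -- joint continuity of `W(σ, θ) = V(cos θ, t - σ)` at `(0, 0)`, where `W = L`
  have hWc : Continuous fun p : ℝ × ℝ => gegenbauerHeat 1 b J (Real.cos p.2) (t - p.1) :=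
    (continuous_gegenbauerHeat 1 b J).comp
      (by fun_prop : Continuous fun p : ℝ × ℝ => (Real.cos p.2, t - p.1))
  rw [Metric.tendsto_nhds]
  intro ε hε
  have hev : ∀ᶠ p : ℝ × ℝ in 𝓝 (0, 0),
      dist (gegenbauerHeat 1 b J (Real.cos p.2) (t - p.1)) L < ε / 4 := by
    have h := hWc.tendsto (0, 0)
    simp only [Real.cos_zero, sub_zero] at h
    exact Metric.tendsto_nhds.1 h (ε / 4) (by positivity)
  obtain ⟨δ₁, hδ₁, hball⟩ := Metric.eventually_nhds_iff.1 hev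
  -- the cut-off radius
  set δ : ℝ := min (δ₁ / 2) (min 1 (ε / (12 * (M + 1)))) with hδdef
  have hδ0 : 0 < δ := lt_min (by positivity) (lt_min one_pos (by positivity))
  have hδδ₁ : δ < δ₁ := (min_le_left _ _).trans_lt (by linarith)
  have hδ1 : δ ≤ 1 := (min_le_right _ _).trans (min_le_left _ _)
  have hδε : δ ≤ ε / (12 * (M + 1)) := (min_le_right _ _).trans (min_le_right _ _)
  have hδπ : δ ≤ π := hδ1.trans (by linarith [Real.two_le_pi])
  -- `M (1 - cos³δ) ≤ ε/8`
  have hcos : M * (1 - Real.cos δ ^ 3) ≤ ε / 8 := by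
    have h1 : 1 - Real.cos δ ^ 3 ≤ 3 * δ ^ 2 / 2 :=
      one_sub_cos_cube_le (by rw [abs_of_pos hδ0]; exact hδ1)
    have h2 : δ ^ 2 ≤ δ := by nlinarith
    have h3 : M * δ ≤ ε / 12 := by
      have h4 : M * δ ≤ M * (ε / (12 * (M + 1))) := mul_le_mul_of_nonneg_left hδε hM0
      have h5 : M * (ε / (12 * (M + 1))) ≤ ε / 12 := by
        rw [mul_div_assoc', div_le_div_iff₀ (by positivity) (by positivity)]
        nlinarith
      linarith
    nlinarith
  -- the two vanishing error terms, and `σ < min(δ₁, 1)`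
  have hT2 : ∀ᶠ σ in 𝓝[>] (0 : ℝ), 2 * M * π * gaussFour σ δ < ε / 4 := by
    have h := ((tendsto_gaussFour_nhdsGT_zero hδ0.ne').const_mul (2 * M * π))
    rw [mul_zero] at h
    exact h.eventually (gt_mem_nhds (by positivity))
  have hT3 : ∀ᶠ σ in 𝓝[>] (0 : ℝ),
      M * ((1 + δ ^ 2 / (4 * σ)) * Real.exp (-δ ^ 2 / (4 * σ))) < ε / 8 := by
    have h := ((tendsto_gaussTailFactor_nhdsGT_zero hδ0.ne').const_mul M)
    rw [mul_zero] at h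
    exact h.eventually (gt_mem_nhds (by positivity))
  have hσδ : ∀ᶠ σ in 𝓝[>] (0 : ℝ), σ < δ₁ := mem_nhdsWithin_of_mem_nhds (Iio_mem_nhds hδ₁)
  have hσ1 : ∀ᶠ σ in 𝓝[>] (0 : ℝ), σ < 1 := mem_nhdsWithin_of_mem_nhds (Iio_mem_nhds one_pos)
  filter_upwards [hT2, hT3, hσδ, hσ1, self_mem_nhdsWithin] with σ h2 h3 hσδ₁ hσ1 hσ0
  rw [mem_Ioi] at hσ0
  have hg : Continuous fun θ => gaussFour σ θ := by unfold gaussFour; fun_prop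
  have hWσ : Continuous fun θ : ℝ => gegenbauerHeat 1 b J (Real.cos θ) (t - σ) :=
    (continuous_gegenbauerHeat 1 b J).comp (by fun_prop : Continuous fun θ : ℝ => (Real.cos θ, t - σ))
  -- pointwise control of `W - L`
  have hnear : ∀ θ ∈ Icc (0 : ℝ) δ, |gegenbauerHeat 1 b J (Real.cos θ) (t - σ) - L| < ε / 4 := by
    intro θ hθ
    have hd : dist (σ, θ) (0, 0) < δ₁ := by
      rw [Prod.dist_eq, Real.dist_eq, Real.dist_eq, sub_zero, sub_zero, max_lt_iff,
        abs_of_pos hσ0, abs_of_nonneg hθ.1]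
      exact ⟨hσδ₁, hθ.2.trans_lt hδδ₁⟩
    have h := hball hd
    rwa [Real.dist_eq] at h
  have hfar : ∀ θ : ℝ, |gegenbauerHeat 1 b J (Real.cos θ) (t - σ) - L| ≤ 2 * M := by
    intro θ
    have h1 : |gegenbauerHeat 1 b J (Real.cos θ) (t - σ)| ≤ M :=
      hM (Real.cos θ) ⟨Real.neg_one_le_cos θ, Real.cos_le_one θ⟩ (t - σ) ⟨by linarith, by linarith⟩
    calc |gegenbauerHeat 1 b J (Real.cos θ) (t - σ) - L|
        ≤ |gegenbauerHeat 1 b J (Real.cos θ) (t - σ)| + |L| := abs_sub _ _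
      _ ≤ 2 * M := by linarith
  -- integrability
  have hI : ∀ a c : ℝ, IntervalIntegrable (fun θ => gaussFour σ θ * Real.sin θ ^ 3 *
      (gegenbauerHeat 1 b J (Real.cos θ) (t - σ) - L)) volume a c := fun a c =>
    ((hg.mul (by fun_prop)).mul (hWσ.sub continuous_const)).intervalIntegrable _ _
  have hIW : IntervalIntegrable (fun θ => gaussFour σ θ * Real.sin θ ^ 3 *
      gegenbauerHeat 1 b J (Real.cos θ) (t - σ)) volume 0 π :=
    ((hg.mul (by fun_prop)).mul hWσ).intervalIntegrable _ _
  have hIm : ∀ a c : ℝ, IntervalIntegrable (fun θ => gaussFour σ θ * Real.sin θ ^ 3) volume a c :=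
    fun a c => (hg.mul (by fun_prop)).intervalIntegrable _ _
  have hgs0 : ∀ θ ∈ Icc (0 : ℝ) π, 0 ≤ gaussFour σ θ * Real.sin θ ^ 3 := fun θ hθ =>
    mul_nonneg (gaussFour_nonneg σ θ) (pow_nonneg (Real.sin_nonneg_of_nonneg_of_le_pi hθ.1 hθ.2) 3)
  -- Step 1: `Ψ(σ) - L = ∫ 𝔤 sin³ (W - L) + L (m - 1)`
  set m := ∫ θ in (0 : ℝ)..π, gaussFour σ θ * Real.sin θ ^ 3 with hm
  have hΨ : gegenbauerHeatGaussPairing b J t σ - L =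
      (∫ θ in (0 : ℝ)..π, gaussFour σ θ * Real.sin θ ^ 3 *
        (gegenbauerHeat 1 b J (Real.cos θ) (t - σ) - L)) + L * (m - 1) := by
    have h1 : ∫ θ in (0 : ℝ)..π, gaussFour σ θ * Real.sin θ ^ 3 *
        (gegenbauerHeat 1 b J (Real.cos θ) (t - σ) - L) =
        (∫ θ in (0 : ℝ)..π, gaussFour σ θ * Real.sin θ ^ 3 *
          gegenbauerHeat 1 b J (Real.cos θ) (t - σ)) - L * m := by
      rw [hm, ← intervalIntegral.integral_const_mul, ← intervalIntegral.integral_sub hIW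
        ((hIm 0 π).const_mul L)]
      exact intervalIntegral.integral_congr fun θ _ => by ring
    rw [h1, gegenbauerHeatGaussPairing]
    ring
  -- Step 2: split at `δ`
  have hsplit := intervalIntegral.integral_add_adjacent_intervals (hI 0 δ) (hI δ π)
  -- Step 3: the head
  have hA : |∫ θ in (0 : ℝ)..δ, gaussFour σ θ * Real.sin θ ^ 3 *
      (gegenbauerHeat 1 b J (Real.cos θ) (t - σ) - L)| ≤ ε / 4 := by
    have h := intervalIntegral.norm_integral_le_of_norm_le hδ0.le
      (f := fun θ => gaussFour σ θ * Real.sin θ ^ 3 * (gegenbauerHeat 1 b J (Real.cos θ) (t - σ) - L))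
      (g := fun θ => gaussFour σ θ * Real.sin θ ^ 3 * (ε / 4))
      (ae_of_all _ fun θ hθ => by
        have hθ' : θ ∈ Icc (0 : ℝ) δ := ⟨hθ.1.le, hθ.2⟩
        have h0 := hgs0 θ ⟨hθ.1.le, hθ.2.trans hδπ⟩
        rw [Real.norm_eq_abs, abs_mul, abs_of_nonneg h0]
        exact mul_le_mul_of_nonneg_left (hnear θ hθ').le h0)
      ((hIm 0 δ).mul_const _)
    rw [Real.norm_eq_abs, intervalIntegral.integral_mul_const] at h
    have hm1 := integral_gaussFour_mul_sin_cube_le_one hσ0 hδ0.le hδπ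
    have hm0 : 0 ≤ ∫ θ in (0 : ℝ)..δ, gaussFour σ θ * Real.sin θ ^ 3 :=
      intervalIntegral.integral_nonneg hδ0.le fun θ hθ => hgs0 θ ⟨hθ.1, hθ.2.trans hδπ⟩
    calc _ ≤ (∫ θ in (0 : ℝ)..δ, gaussFour σ θ * Real.sin θ ^ 3) * (ε / 4) := h
      _ ≤ 1 * (ε / 4) := mul_le_mul_of_nonneg_right hm1 (by positivity)
      _ = ε / 4 := one_mul _
  -- Step 4: the tail
  have hB : |∫ θ in δ..π, gaussFour σ θ * Real.sin θ ^ 3 *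
      (gegenbauerHeat 1 b J (Real.cos θ) (t - σ) - L)| ≤ 2 * M * π * gaussFour σ δ := by
    have h := intervalIntegral.norm_integral_le_of_norm_le hδπ
      (f := fun θ => gaussFour σ θ * Real.sin θ ^ 3 * (gegenbauerHeat 1 b J (Real.cos θ) (t - σ) - L))
      (g := fun θ => gaussFour σ θ * Real.sin θ ^ 3 * (2 * M))
      (ae_of_all _ fun θ hθ => by
        have h0 := hgs0 θ ⟨hδ0.le.trans hθ.1.le, hθ.2⟩
        rw [Real.norm_eq_abs, abs_mul, abs_of_nonneg h0]
        exact mul_le_mul_of_nonneg_left (hfar θ) h0)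
      ((hIm δ π).mul_const _)
    rw [Real.norm_eq_abs, intervalIntegral.integral_mul_const] at h
    have htail := integral_gaussFour_mul_sin_cube_tail_le hσ0 hδ0.le hδπ
    calc _ ≤ (∫ θ in δ..π, gaussFour σ θ * Real.sin θ ^ 3) * (2 * M) := h
      _ ≤ π * gaussFour σ δ * (2 * M) := mul_le_mul_of_nonneg_right htail (by positivity)
      _ = 2 * M * π * gaussFour σ δ := by ring
  -- Step 5: the mass defect
  have hC : |L * (m - 1)| ≤ M * (1 - Real.cos δ ^ 3) +
      M * ((1 + δ ^ 2 / (4 * σ)) * Real.exp (-δ ^ 2 / (4 * σ))) := by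
    set E := (1 + δ ^ 2 / (4 * σ)) * Real.exp (-δ ^ 2 / (4 * σ)) with hE
    have hm1 : m ≤ 1 := integral_gaussFour_mul_sin_cube_le_one hσ0 Real.pi_pos.le le_rfl
    have hms : (∫ θ in (0 : ℝ)..δ, gaussFour σ θ * Real.sin θ ^ 3) +
        (∫ θ in δ..π, gaussFour σ θ * Real.sin θ ^ 3) = m :=
      intervalIntegral.integral_add_adjacent_intervals (hIm 0 δ) (hIm δ π)
    have htail0 : 0 ≤ ∫ θ in δ..π, gaussFour σ θ * Real.sin θ ^ 3 :=
      intervalIntegral.integral_nonneg hδπ fun θ hθ => hgs0 θ ⟨hδ0.le.trans hθ.1, hθ.2⟩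
    have hhead : Real.cos δ ^ 3 * (1 - E) ≤ ∫ θ in (0 : ℝ)..δ, gaussFour σ θ * Real.sin θ ^ 3 :=
      le_integral_gaussFour_mul_sin_cube hσ0 hδ0.le hδ1
    have hc0 : 0 ≤ Real.cos δ :=
      Real.cos_nonneg_of_mem_Icc ⟨by linarith [Real.pi_pos], hδ1.trans (by linarith [Real.two_le_pi])⟩
    have hcos3 : Real.cos δ ^ 3 ≤ 1 := pow_le_one₀ hc0 (Real.cos_le_one δ)
    have hcos0 : 0 ≤ Real.cos δ ^ 3 := pow_nonneg hc0 3
    have hE0 : 0 ≤ E := by positivity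
    have h1m : 1 - m ≤ (1 - Real.cos δ ^ 3) + E := by nlinarith
    rw [abs_mul, abs_sub_comm, abs_of_nonneg (by linarith : (0 : ℝ) ≤ 1 - m)]
    calc |L| * (1 - m) ≤ M * (1 - m) := mul_le_mul_of_nonneg_right hLM (by linarith)
      _ ≤ M * ((1 - Real.cos δ ^ 3) + E) := mul_le_mul_of_nonneg_left h1m hM0
      _ = M * (1 - Real.cos δ ^ 3) + M * E := by ring
  -- conclusion
  rw [Real.dist_eq, hΨ, ← hsplit]
  calc _ ≤ |(∫ θ in (0 : ℝ)..δ, gaussFour σ θ * Real.sin θ ^ 3 *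
          (gegenbauerHeat 1 b J (Real.cos θ) (t - σ) - L)) +
        ∫ θ in δ..π, gaussFour σ θ * Real.sin θ ^ 3 *
          (gegenbauerHeat 1 b J (Real.cos θ) (t - σ) - L)| + |L * (m - 1)| := abs_add_le _ _
    _ ≤ (|∫ θ in (0 : ℝ)..δ, gaussFour σ θ * Real.sin θ ^ 3 *
          (gegenbauerHeat 1 b J (Real.cos θ) (t - σ) - L)| +
        |∫ θ in δ..π, gaussFour σ θ * Real.sin θ ^ 3 *
          (gegenbauerHeat 1 b J (Real.cos θ) (t - σ) - L)|) + |L * (m - 1)| := by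
        gcongr; exact abs_add_le _ _
    _ < ε := by linarith

/-- **Cheeger–Yau comparison for the polynomial heat flow of `S⁴`** (Duhamel form, at the pole):
if `p = V(·, 0) ≥ 0` on `[-1, 1]` then for every `t > 0`
`∫_0^π 𝔤(t, θ) sin³θ p(cos θ) dθ ≤ (P_t p)(1) = V(1, t)`, i.e. the Euclidean kernel
`2π² (4πt)⁻² e^{-θ²/4t}` paired with `p` over `S⁴` (in geodesic polar coordinates about the pole) is at
most the heat flow of `p` evaluated at the pole: `Ψ(t) ≤ Ψ(σ) → V(1, t)` (`σ → 0⁺`).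
[cite: Davies1989, Thm 5.6.1] -/
theorem integral_gaussFour_mul_le_gegenbauerHeat
    (h0 : ∀ s ∈ Icc (-1 : ℝ) 1, 0 ≤ gegenbauerHeat 1 b J s 0) {t : ℝ} (ht : 0 < t) :
    ∫ θ in (0 : ℝ)..π, gaussFour t θ * Real.sin θ ^ 3 * gegenbauerHeat 1 b J (Real.cos θ) 0 ≤
      gegenbauerHeat 1 b J 1 t := by
  have hΨt : gegenbauerHeatGaussPairing b J t t =
      ∫ θ in (0 : ℝ)..π, gaussFour t θ * Real.sin θ ^ 3 * gegenbauerHeat 1 b J (Real.cos θ) 0 := by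
    simp only [gegenbauerHeatGaussPairing, sub_self]
  have hev : ∀ᶠ σ in 𝓝[>] (0 : ℝ),
      gegenbauerHeatGaussPairing b J t t ≤ gegenbauerHeatGaussPairing b J t σ := by
    filter_upwards [Ioc_mem_nhdsGT ht] with σ hσ
    exact gegenbauerHeatGaussPairing_le b J h0 hσ.1 hσ.2
  rw [← hΨt]
  exact ge_of_tendsto (tendsto_gegenbauerHeatGaussPairing b J t) hev

/-- The same in the variable `s = cos θ`: **for `p = Σ_{j<J} b_j C_j^{(3/2)} ≥ 0` on `[-1, 1]` and
`t > 0`, `∫_{-1}^{1} (1-s²) · e^{-arccos(s)²/4t}/(8t²) · p(s) ds ≤ (P_t p)(1)`.**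
[cite: Davies1989, Thm 5.6.1] -/
theorem integral_weightOne_mul_gaussArccos_mul_le_gegenbauerHeat
    (h0 : ∀ s ∈ Icc (-1 : ℝ) 1, 0 ≤ gegenbauerHeat 1 b J s 0) {t : ℝ} (ht : 0 < t) :
    ∫ s in (-1 : ℝ)..1, (1 - s ^ 2) * (Real.exp (-Real.arccos s ^ 2 / (4 * t)) / (8 * t ^ 2)) *
        gegenbauerHeat 1 b J s 0 ≤ gegenbauerHeat 1 b J 1 t := by
  have hp : Continuous fun s : ℝ => gegenbauerHeat 1 b J s 0 :=
    (continuous_gegenbauerHeat 1 b J).comp (Continuous.prodMk_left (0 : ℝ))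
  set g : ℝ → ℝ := fun s => (1 - s ^ 2) * (Real.exp (-Real.arccos s ^ 2 / (4 * t)) / (8 * t ^ 2)) *
    gegenbauerHeat 1 b J s 0 with hg
  have hgc : Continuous g := by
    simp only [hg]
    exact ((by fun_prop : Continuous fun s : ℝ => 1 - s ^ 2).mul
      ((Real.continuous_exp.comp ((Real.continuous_arccos.pow 2).neg.div_const _)).div_const _)).mul hp
  -- substitution `s = cos θ`
  have hsub := intervalIntegral.integral_comp_mul_deriv (a := (0 : ℝ)) (b := π) (f := Real.cos)
    (f' := fun θ => -Real.sin θ) (g := g) (fun θ _ => Real.hasDerivAt_cos θ)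
    (by fun_prop : Continuous fun θ : ℝ => -Real.sin θ).continuousOn hgc
  rw [Real.cos_zero, Real.cos_pi, intervalIntegral.integral_symm (-1 : ℝ) 1] at hsub
  have hint : ∫ θ in (0 : ℝ)..π, (g ∘ Real.cos) θ * -Real.sin θ =
      -∫ θ in (0 : ℝ)..π, gaussFour t θ * Real.sin θ ^ 3 * gegenbauerHeat 1 b J (Real.cos θ) 0 := by
    rw [← intervalIntegral.integral_neg]
    refine intervalIntegral.integral_congr fun θ hθ => ?_
    rw [uIcc_of_le Real.pi_pos.le] at hθ
    simp only [Function.comp, hg, gaussFour, Real.arccos_cos hθ.1 hθ.2]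
    have hsc := Real.sin_sq_add_cos_sq θ
    have : 1 - Real.cos θ ^ 2 = Real.sin θ ^ 2 := by linarith
    rw [this]
    ring
  rw [hint, neg_inj] at hsub
  rw [← hsub]
  exact integral_gaussFour_mul_le_gegenbauerHeat b J h0 ht

end Limit

end Literature.Analysis.SpecialFunctions
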